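import Mathlib.Analysis.SpecialFunctions.Pow.Real
import Summits.Ventures.Crystal3D.StickySpheres.ContactGraph
import HarnessLib

/-!
# Removing a low-degree ball: the induction that feeds the surface LP

HONEST FRAMING. Part of the venture `Summits/Ventures/Crystal3D` (cell `pub-crystal3d`, PLAN
amendment R11 "vertex-removal induction"). Everything in this file is PROVED; it contains no
geometry beyond counting and no claim about crystallization. Purpose: the cell's surface LP
(`6N - γ N^{2/3}`) is only applied to packings in which every ball has more than `k₀` contacts;
balls with `≤ k₀` contacts are removed one at a time, which costs at most `k₀` contacts and is
paid for by the growth of `6N - γ N^{2/3}` as long as `γ ((N+1)^{2/3} - N^{2/3}) ≤ 6 - k₀`.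

## Content

* `numContacts_succAbove_add_coordination` — removing ball `i` from a configuration of `N + 1`
  balls loses exactly `coordination x i` contacts:
  `C(x) = C(x ∘ i.succAbove) + deg(i)`.
* `numContacts_le_choose_two` — `C(x) ≤ N(N-1)/2` (for base cases).
* `rpow_two_thirds_succ_sub_le` — `(t+1)^{2/3} - t^{2/3} ≤ 2 / (3 t^{1/3})` for `t > 0`
  (from `2b³ - 3ab² + a³ = (b-a)²(2b+a) ≥ 0` with `a = t^{1/3}`, `b = (t+1)^{1/3}`), and the
  threshold form `step_of_threshold`.
* `surfaceBound_of_reduction` — THE WRAPPER: base cases for `2 ≤ N ≤ N₁`, the step inequality for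
  `N ≥ N₁`, and the (LP-supplied) bound for packings of `N > N₁` balls all of whose balls have
  `> k₀` contacts, together give `C(x) < 6N - γ N^{2/3}` for every packing of every `N ≥ 2` balls
  (the unfolded form of `Statement.SurfaceBound γ`).
-/

noncomputable section

open scoped BigOperators
open Finset

namespace Summit.Ventures.Crystal3D

variable {d N : ℕ}

/-! ## Counting: indicator forms and the removal identity -/

/-- Indicator form of the contact number: `C(x) = ∑_{a,b} [a < b ∧ |x a - x b| = 1]`. -/
theorem numContacts_eq_sum_ite (x : Fin N → EuclideanSpace ℝ (Fin d)) :
    numContacts x = ∑ a, ∑ b, if a < b ∧ dist (x a) (x b) = 1 then 1 else 0 := by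
  rw [numContacts, contactPairs, card_filter, Fintype.sum_prod_type]

/-- Indicator form of the coordination number: `deg(i) = ∑_j [j ≠ i ∧ |x i - x j| = 1]`. -/
theorem coordination_eq_sum_ite (x : Fin N → EuclideanSpace ℝ (Fin d)) (i : Fin N) :
    coordination x i = ∑ j, if j ≠ i ∧ dist (x i) (x j) = 1 then 1 else 0 := by
  rw [coordination, contactNeighbors, card_filter]

/-- **Removal identity.** Deleting ball `i` from a configuration of `N + 1` balls removes exactly
its `coordination x i` contacts: `C(x) = C(x ∘ i.succAbove) + deg(i)`. -/
theorem numContacts_succAbove_add_coordination (x : Fin (N + 1) → EuclideanSpace ℝ (Fin d))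
    (i : Fin (N + 1)) :
    numContacts x = numContacts (fun a => x (i.succAbove a)) + coordination x i := by
  -- peel off the index `i` in the outer sum and in every inner sum
  have E1 := Fin.sum_univ_succAbove
    (fun a => ∑ b, if a < b ∧ dist (x a) (x b) = 1 then (1 : ℕ) else 0) i
  have E2 := Fin.sum_univ_succAbove
    (fun b => if i < b ∧ dist (x i) (x b) = 1 then (1 : ℕ) else 0) i
  have E3 : ∀ a' : Fin N,
      (∑ b, if i.succAbove a' < b ∧ dist (x (i.succAbove a')) (x b) = 1 then (1 : ℕ) else 0) =
        (if i.succAbove a' < i ∧ dist (x (i.succAbove a')) (x i) = 1 then 1 else 0) +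
          ∑ b', if a' < b' ∧ dist (x (i.succAbove a')) (x (i.succAbove b')) = 1 then 1 else 0 := by
    intro a'
    rw [Fin.sum_univ_succAbove _ i]
    simp only [Fin.succAbove_lt_succAbove_iff]
  -- the two boundary sums recombine into the coordination number of `i`
  have E4 : ∀ a' : Fin N,
      ((if i < i.succAbove a' ∧ dist (x i) (x (i.succAbove a')) = 1 then (1 : ℕ) else 0) +
        if i.succAbove a' < i ∧ dist (x (i.succAbove a')) (x i) = 1 then 1 else 0) =
        if dist (x i) (x (i.succAbove a')) = 1 then 1 else 0 := by
    intro a'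
    rw [dist_comm (x (i.succAbove a')) (x i)]
    rcases lt_or_gt_of_ne (Fin.succAbove_ne i a') with h | h
    · simp [h, not_lt.2 h.le]
    · simp [h, not_lt.2 h.le]
  have E5 : coordination x i =
      ∑ a', ((if i < i.succAbove a' ∧ dist (x i) (x (i.succAbove a')) = 1 then (1 : ℕ) else 0) +
        if i.succAbove a' < i ∧ dist (x (i.succAbove a')) (x i) = 1 then 1 else 0) := by
    rw [coordination_eq_sum_ite, Fin.sum_univ_succAbove _ i]
    simp only [ne_eq, not_true_eq_false, false_and, if_false, zero_add, Fin.succAbove_ne,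
      not_false_eq_true, true_and]
    exact sum_congr rfl fun a' _ => (E4 a').symm
  rw [numContacts_eq_sum_ite, numContacts_eq_sum_ite, E1, E2, E5]
  simp only [lt_self_iff_false, false_and, if_false, zero_add, E3, sum_add_distrib]
  ring

/-- A sub-configuration has at most as many contacts: `C(x ∘ i.succAbove) ≤ C(x)`. -/
theorem numContacts_succAbove_le (x : Fin (N + 1) → EuclideanSpace ℝ (Fin d)) (i : Fin (N + 1)) :
    numContacts (fun a => x (i.succAbove a)) ≤ numContacts x := by
  rw [numContacts_succAbove_add_coordination x i]; exact Nat.le_add_right _ _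

/-- `2 C(x) ≤ N (N - 1)`, from the handshake identity and `deg ≤ N - 1`. -/
theorem two_mul_numContacts_le_mul_pred (x : Fin N → EuclideanSpace ℝ (Fin d)) :
    2 * numContacts x ≤ N * (N - 1) := by
  rw [← sum_coordination_eq]
  calc ∑ i, coordination x i ≤ ∑ _i : Fin N, (N - 1) := sum_le_sum fun i _ => coordination_le x i
    _ = N * (N - 1) := by simp

/-- `C(x) ≤ N (N - 1) / 2` as a real inequality (base cases of the induction). -/
theorem numContacts_le_choose_two (x : Fin N → EuclideanSpace ℝ (Fin d)) :
    (numContacts x : ℝ) ≤ (N : ℝ) * ((N : ℝ) - 1) / 2 := by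
  have h := two_mul_numContacts_le_mul_pred x
  rcases Nat.eq_zero_or_pos N with hN | hN
  · subst hN
    have : numContacts x = 0 := by
      have := numContacts_le_sq x; simpa using this
    simp [this]
  · have hcast : ((N * (N - 1) : ℕ) : ℝ) = (N : ℝ) * ((N : ℝ) - 1) := by
      rw [Nat.cast_mul, Nat.cast_sub hN]; simp
    have h' : (2 * numContacts x : ℝ) ≤ (N : ℝ) * ((N : ℝ) - 1) := by
      rw [← hcast]; exact_mod_cast h
    linarith

/-! ## The step inequality `(t+1)^{2/3} - t^{2/3} ≤ 2 / (3 t^{1/3})` -/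

/-- For `t > 0`: `(t + 1)^{2/3} - t^{2/3} ≤ 2 / (3 t^{1/3})` — with `a = t^{1/3}`,
`b = (t+1)^{1/3}` this is `3a(b² - a²) ≤ 2(b³ - a³)`, i.e. `(b - a)²(2b + a) ≥ 0`. -/
theorem rpow_two_thirds_succ_sub_le {t : ℝ} (ht : 0 < t) :
    (t + 1) ^ ((2 : ℝ) / 3) - t ^ ((2 : ℝ) / 3) ≤ 2 / (3 * t ^ ((1 : ℝ) / 3)) := by
  set a := t ^ ((1 : ℝ) / 3) with ha
  set b := (t + 1) ^ ((1 : ℝ) / 3) with hb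
  have ha0 : 0 < a := Real.rpow_pos_of_pos ht _
  have hb0 : 0 < b := Real.rpow_pos_of_pos (by linarith) _
  have ha3 : a ^ 3 = t := by
    rw [ha, ← Real.rpow_natCast, ← Real.rpow_mul ht.le]; norm_num
  have hb3 : b ^ 3 = t + 1 := by
    rw [hb, ← Real.rpow_natCast, ← Real.rpow_mul (by linarith)]; norm_num
  have ha2 : t ^ ((2 : ℝ) / 3) = a ^ 2 := by
    rw [ha, ← Real.rpow_natCast, ← Real.rpow_mul ht.le]; norm_num
  have hb2 : (t + 1) ^ ((2 : ℝ) / 3) = b ^ 2 := by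
    rw [hb, ← Real.rpow_natCast, ← Real.rpow_mul (by linarith)]; norm_num
  rw [ha2, hb2, le_div_iff₀ (by positivity)]
  have key : 0 ≤ (b - a) ^ 2 * (2 * b + a) := by positivity
  nlinarith [key, ha3, hb3]

/-- `t ↦ t^{1/3}` is monotone, so the step bound improves with `t`: for `t ≥ s > 0`,
`2 / (3 t^{1/3}) ≤ 2 / (3 s^{1/3})`. -/
theorem two_div_rpow_third_antitone {s t : ℝ} (hs : 0 < s) (hst : s ≤ t) :
    2 / (3 * t ^ ((1 : ℝ) / 3)) ≤ 2 / (3 * s ^ ((1 : ℝ) / 3)) := by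
  have hs' : 0 < s ^ ((1 : ℝ) / 3) := Real.rpow_pos_of_pos hs _
  have hmono : s ^ ((1 : ℝ) / 3) ≤ t ^ ((1 : ℝ) / 3) :=
    Real.rpow_le_rpow hs.le hst (by norm_num)
  exact div_le_div_of_nonneg_left (by norm_num) (by positivity) (by linarith)

/-- **Threshold form of the step condition.** If `γ ≥ 0` and `2 γ ≤ 3 (6 - k₀) N₁^{1/3}` with
`N₁ ≥ 1`, then `γ ((N+1)^{2/3} - N^{2/3}) ≤ 6 - k₀` for every `N ≥ N₁`. -/
theorem step_of_threshold {γ : ℝ} {k₀ N₁ : ℕ} (hγ : 0 ≤ γ) (hN₁ : 1 ≤ N₁)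
    (h : 2 * γ ≤ 3 * (6 - (k₀ : ℝ)) * (N₁ : ℝ) ^ ((1 : ℝ) / 3)) :
    ∀ N : ℕ, N₁ ≤ N →
      γ * (((N : ℝ) + 1) ^ ((2 : ℝ) / 3) - (N : ℝ) ^ ((2 : ℝ) / 3)) ≤ 6 - (k₀ : ℝ) := by
  intro N hN
  have hN₁' : (0 : ℝ) < N₁ := by exact_mod_cast hN₁
  have hN' : (0 : ℝ) < N := by exact_mod_cast (lt_of_lt_of_le hN₁ hN)
  have hc : (0 : ℝ) < (N₁ : ℝ) ^ ((1 : ℝ) / 3) := Real.rpow_pos_of_pos hN₁' _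
  have h1 := rpow_two_thirds_succ_sub_le hN'
  have h2 := two_div_rpow_third_antitone hN₁' (show (N₁ : ℝ) ≤ N by exact_mod_cast hN)
  have h3 : γ * (2 / (3 * (N₁ : ℝ) ^ ((1 : ℝ) / 3))) ≤ 6 - (k₀ : ℝ) := by
    rw [mul_div_assoc', div_le_iff₀ (by positivity)]
    linarith
  calc γ * (((N : ℝ) + 1) ^ ((2 : ℝ) / 3) - (N : ℝ) ^ ((2 : ℝ) / 3))
      ≤ γ * (2 / (3 * (N₁ : ℝ) ^ ((1 : ℝ) / 3))) :=
        mul_le_mul_of_nonneg_left (h1.trans h2) hγ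
    _ ≤ 6 - (k₀ : ℝ) := h3

/-! ## The wrapper: base cases + step condition + LP on reduced packings ⇒ the surface bound -/

/-- **Vertex-removal induction.** Suppose: (base) every packing of `2 ≤ N ≤ N₁` balls satisfies
`C < 6N - γN^{2/3}`; (step) `γ((N+1)^{2/3} - N^{2/3}) ≤ 6 - k₀` for `N ≥ N₁`; (LP) every packing
of `N > N₁` balls ALL of whose balls have more than `k₀` contacts satisfies `C < 6N - γN^{2/3}`.
Then every packing of every `N ≥ 2` balls satisfies `C < 6N - γ N^{2/3}` (the unfolded form of
`SurfaceBound γ`). Requires `N₁ ≥ 2`. -/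
theorem surfaceBound_of_reduction {γ : ℝ} {k₀ N₁ : ℕ} (hN₁ : 2 ≤ N₁)
    (hbase : ∀ N : ℕ, 2 ≤ N → N ≤ N₁ → ∀ x : Fin N → EuclideanSpace ℝ (Fin 3),
      IsUnitPacking x → (numContacts x : ℝ) < 6 * N - γ * (N : ℝ) ^ ((2 : ℝ) / 3))
    (hstep : ∀ N : ℕ, N₁ ≤ N →
      γ * (((N : ℝ) + 1) ^ ((2 : ℝ) / 3) - (N : ℝ) ^ ((2 : ℝ) / 3)) ≤ 6 - (k₀ : ℝ))
    (hLP : ∀ N : ℕ, N₁ < N → ∀ x : Fin N → EuclideanSpace ℝ (Fin 3), IsUnitPacking x →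
      (∀ i, k₀ < coordination x i) → (numContacts x : ℝ) < 6 * N - γ * (N : ℝ) ^ ((2 : ℝ) / 3)) :
    ∀ N : ℕ, 2 ≤ N → ∀ x : Fin N → EuclideanSpace ℝ (Fin 3), IsUnitPacking x →
      (numContacts x : ℝ) < 6 * N - γ * (N : ℝ) ^ ((2 : ℝ) / 3) := by
  intro N
  induction N using Nat.strong_induction_on with
  | _ N ih =>
    intro hN x hx
    by_cases hle : N ≤ N₁
    · exact hbase N hN hle x hx
    · have hlt : N₁ < N := not_le.1 hle
      by_cases hall : ∀ i, k₀ < coordination x i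
      · exact hLP N hlt x hx hall
      · obtain ⟨i, hi⟩ : ∃ i, coordination x i ≤ k₀ := by
          by_contra hcon
          exact hall fun i => not_le.1 fun hle => hcon ⟨i, hle⟩
        -- `N = M + 1` with `N₁ ≤ M`; remove ball `i`
        obtain ⟨M, rfl⟩ : ∃ M, N = M + 1 := ⟨N - 1, by omega⟩
        have hM₁ : N₁ ≤ M := by omega
        have hM2 : 2 ≤ M := le_trans hN₁ hM₁
        have hx'P : IsUnitPacking (fun a => x (i.succAbove a)) :=
          hx.comp Fin.succAbove_right_injective
        have hIH := ih M (Nat.lt_succ_self M) hM2 _ hx'P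
        have hrem := numContacts_succAbove_add_coordination x i
        have hC : (numContacts x : ℝ) ≤ numContacts (fun a => x (i.succAbove a)) + k₀ := by
          have : numContacts x ≤ numContacts (fun a => x (i.succAbove a)) + k₀ := by
            rw [hrem]; omega
          exact_mod_cast this
        have hs := hstep M hM₁
        push_cast
        linarith

end Summit.Ventures.Crystal3D

end
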